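import Summits.MatrixMultiplication.MatrixMultiplication.Theses.DesignFlattening

/-!
# `GrowingHostDesigns` (crux `stmt-MatrixMultiplication-8033`, route `DesignFlattening`):
# load-bearing guards and non-vacuity of the hosting clause (negative-side support)

Support file of the refuter's crux attack (one cycle of basic attacks).  The crux `X` says: for every
`η > 0` there are a finite abelian `G`, a kept set `P ⊆ G × G`, `p ≥ 1` blocks of `⟨m,m,m⟩` with
`m ≥ 2`, hosted ON THE NOSE in the punctured table `[b + c = a ∧ (b,c) ∈ P]` by index maps
`α β γ`, and `N ≥ 1` with a completion `S` of the `N`-th power, `(U_G·1_P)^{⊗N} = U_G^{⊗N} ∘ S`,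
of cost `|G|^N · R(S) ≤ (p · m^{2+η})^N`.  Proved here, `sorry`-free:

* `hosting_two_by_two` — the hosting clause is SATISFIABLE with the tree's actual
  `matMulDirectSum` convention, already at the minimum size `|G| = m²`: `p = 1`, `m = 2`,
  `G = ZMod 2 × ZMod 2`, kept set `{b.2 + c.1 = 0}`, maps `α(κ,ν) = (κ,ν)`, `β(κ',μ) = (κ'+μ, μ)`,
  `γ(μ',ν') = (−μ', ν'−μ')` (the `m = 2` instance of the birth skeleton's tight square host;
  `decide` over the 64 index triples);
* `growingHostDesigns_trivial_without_N_guard` — with `1 ≤ N` dropped the statement is junk-true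
  (`N = 0`: both Kronecker powers are the scalar `1`, `S = 1`, cost `1 · 1 ≤ 1`);
* `growingHostDesigns_trivial_without_p_guard` — with `1 ≤ p` dropped it is junk-true
  (`p = 0`: empty block type, hosting vacuous, `P = ∅`, `S = 0`, `R(0) = 0`, cost `0 ≤ 0`);
* `growingHostDesigns_trivial_without_m_guard` — with `2 ≤ m` dropped it is junk-true
  (`m = 1`: `⟨1,1,1⟩` in the trivial group `ZMod 1`, `P` = everything, `S = 1`, cost `1 ≤ 1`).

So each of the three numeric guards of `X` is load-bearing and none is missing: with all three in
place on-the-nose hosting forces `α` injective, `|G| ≥ p·m²`, and the cost window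
`p·m² ≤ |G|·R(S)^{1/N} ≤ p·m^{2+η}` is genuine (no degenerate witness).  None of these theorems
asserts a Theses decl positively.
-/

set_option linter.dupNamespace false

open scoped BigOperators
open Literature.Computability.AlgebraicComplexity

namespace Summit.MatrixMultiplication.MatrixMultiplication.Theorems.GrowingHostDesigns.Negative

/-- NON-VACUITY of the hosting clause of `GrowingHostDesigns` at `p = 1`, `m = 2`, `|G| = m² = 4`:
the tight square host `G = ZMod 2 × ZMod 2`, kept set `{(b, c) | b.2 + c.1 = 0}`, hosts `⟨2,2,2⟩`
on the nose (maps `α(κ,ν) = (κ,ν)`, `β(κ',μ) = (κ'+μ, μ)`, `γ(μ',ν') = (−μ', ν'−μ')`). [folklore] -/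
theorem hosting_two_by_two :
    ∃ α β γ : (Σ _ : Fin 1, Fin 2 × Fin 2) → ZMod 2 × ZMod 2,
      ∀ x y z : (Σ _ : Fin 1, Fin 2 × Fin 2),
        matMulDirectSum ℂ (fun _ : Fin 1 => 2) (fun _ : Fin 1 => 2) (fun _ : Fin 1 => 2) x y z =
          (if β y + γ z = α x ∧ (β y, γ z) ∈
              (Finset.univ.filter fun bc : (ZMod 2 × ZMod 2) × (ZMod 2 × ZMod 2) =>
                bc.1.2 + bc.2.1 = 0)
            then (1 : ℂ) else 0) := by
  refine ⟨fun x => (((x.2.1 : ℕ) : ZMod 2), ((x.2.2 : ℕ) : ZMod 2)),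
    fun y => (((y.2.1 : ℕ) : ZMod 2) + ((y.2.2 : ℕ) : ZMod 2), ((y.2.2 : ℕ) : ZMod 2)),
    fun z => (-((z.2.1 : ℕ) : ZMod 2), ((z.2.2 : ℕ) : ZMod 2) - ((z.2.1 : ℕ) : ZMod 2)),
    fun x y z => ?_⟩
  unfold matMulDirectSum
  refine if_congr ?_ rfl rfl
  revert x y z
  decide

/-- The rank of a constant-one 3-tensor on finite index types is at most one. [folklore] -/
theorem tensorRank_const_one_le {ι κ μ : Type} [Fintype ι] [Fintype κ] [Fintype μ] :
    tensorRank (fun (_ : ι) (_ : κ) (_ : μ) => (1 : ℂ)) ≤ 1 := by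
  refine tensorRank_le_of_eq_sum (fun _ _ => 1) (fun _ _ => 1) (fun _ _ => 1) ?_
  funext a b c
  simp [triad]

/-- LOAD-BEARING GUARD `1 ≤ N`: `GrowingHostDesigns` with the conjunct `1 ≤ N` deleted is junk-true
(witness `N = 0` on top of the genuine hosting `hosting_two_by_two`: `t^{⊗0} = 1`, `S = 1`,
`|G|^0 · R(S) ≤ 1 = (p·m^{2+η})^0`). [folklore] -/
theorem growingHostDesigns_trivial_without_N_guard :
    ∀ η : ℝ, 0 < η → ∃ (G : Type) (_ : AddCommGroup G) (_ : Fintype G) (_ : DecidableEq G)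
      (P : Finset (G × G)) (p m N : ℕ), 1 ≤ p ∧ 2 ≤ m ∧
      (∃ α β γ : (Σ _ : Fin p, Fin m × Fin m) → G, ∀ x y z : (Σ _ : Fin p, Fin m × Fin m),
        matMulDirectSum ℂ (fun _ : Fin p => m) (fun _ : Fin p => m) (fun _ : Fin p => m) x y z =
          (if β y + γ z = α x ∧ (β y, γ z) ∈ P then (1 : ℂ) else 0)) ∧
      ∃ S : (Fin N → G) → (Fin N → G) → (Fin N → G) → ℂ,
        (∀ a b c : Fin N → G,
          kroneckerPow (fun a b c : G => if b + c = a ∧ (b, c) ∈ P then (1 : ℂ) else 0) N a b c =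
            kroneckerPow (fun a b c : G => if b + c = a then (1 : ℂ) else 0) N a b c * S a b c) ∧
        (Fintype.card G : ℝ) ^ N * (tensorRank S : ℝ) ≤ ((p : ℝ) * (m : ℝ) ^ (2 + η)) ^ N := by
  intro η _
  refine ⟨ZMod 2 × ZMod 2, inferInstance, inferInstance, inferInstance,
    (Finset.univ.filter fun bc : (ZMod 2 × ZMod 2) × (ZMod 2 × ZMod 2) => bc.1.2 + bc.2.1 = 0),
    1, 2, 0, le_rfl, le_rfl, hosting_two_by_two, fun _ _ _ => 1, ?_, ?_⟩
  · intro a b c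
    simp [kroneckerPow]
  · have h := (tensorRank_const_one_le (ι := Fin 0 → ZMod 2 × ZMod 2)
      (κ := Fin 0 → ZMod 2 × ZMod 2) (μ := Fin 0 → ZMod 2 × ZMod 2))
    have h' : (tensorRank (fun (_ : Fin 0 → ZMod 2 × ZMod 2) (_ : Fin 0 → ZMod 2 × ZMod 2)
        (_ : Fin 0 → ZMod 2 × ZMod 2) => (1 : ℂ)) : ℝ) ≤ 1 := by exact_mod_cast h
    simpa using h'

/-- LOAD-BEARING GUARD `1 ≤ p`: `GrowingHostDesigns` with the conjunct `1 ≤ p` deleted is junk-true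
(witness `p = 0`: the block index type `Fin 0` is empty so hosting is vacuous; `P = ∅`, `S = 0`,
`R(0) = 0`, cost `|G|^N · 0 ≤ 0 = (0 · m^{2+η})^N`). [folklore] -/
theorem growingHostDesigns_trivial_without_p_guard :
    ∀ η : ℝ, 0 < η → ∃ (G : Type) (_ : AddCommGroup G) (_ : Fintype G) (_ : DecidableEq G)
      (P : Finset (G × G)) (p m N : ℕ), 2 ≤ m ∧ 1 ≤ N ∧
      (∃ α β γ : (Σ _ : Fin p, Fin m × Fin m) → G, ∀ x y z : (Σ _ : Fin p, Fin m × Fin m),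
        matMulDirectSum ℂ (fun _ : Fin p => m) (fun _ : Fin p => m) (fun _ : Fin p => m) x y z =
          (if β y + γ z = α x ∧ (β y, γ z) ∈ P then (1 : ℂ) else 0)) ∧
      ∃ S : (Fin N → G) → (Fin N → G) → (Fin N → G) → ℂ,
        (∀ a b c : Fin N → G,
          kroneckerPow (fun a b c : G => if b + c = a ∧ (b, c) ∈ P then (1 : ℂ) else 0) N a b c =
            kroneckerPow (fun a b c : G => if b + c = a then (1 : ℂ) else 0) N a b c * S a b c) ∧
        (Fintype.card G : ℝ) ^ N * (tensorRank S : ℝ) ≤ ((p : ℝ) * (m : ℝ) ^ (2 + η)) ^ N := by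
  intro η _
  refine ⟨ZMod 2, inferInstance, inferInstance, inferInstance, ∅, 0, 2, 1, le_rfl, le_rfl,
    ⟨fun x => x.1.elim0, fun x => x.1.elim0, fun x => x.1.elim0, fun x => x.1.elim0⟩,
    0, ?_, ?_⟩
  · intro a b c
    simp [kroneckerPow]
  · have h0 : tensorRank (0 : (Fin 1 → ZMod 2) → (Fin 1 → ZMod 2) → (Fin 1 → ZMod 2) → ℂ) = 0 :=
      tensorRank_zero
    simp [h0]

/-- LOAD-BEARING GUARD `2 ≤ m`: `GrowingHostDesigns` with the conjunct `2 ≤ m` deleted is junk-true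
(witness `m = 1`, `p = N = 1`: `⟨1,1,1⟩` is hosted in the trivial group `ZMod 1` with everything
kept, `S = 1`, cost `1 · R(1) ≤ 1 = 1 · 1^{2+η}`). [folklore] -/
theorem growingHostDesigns_trivial_without_m_guard :
    ∀ η : ℝ, 0 < η → ∃ (G : Type) (_ : AddCommGroup G) (_ : Fintype G) (_ : DecidableEq G)
      (P : Finset (G × G)) (p m N : ℕ), 1 ≤ p ∧ 1 ≤ N ∧
      (∃ α β γ : (Σ _ : Fin p, Fin m × Fin m) → G, ∀ x y z : (Σ _ : Fin p, Fin m × Fin m),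
        matMulDirectSum ℂ (fun _ : Fin p => m) (fun _ : Fin p => m) (fun _ : Fin p => m) x y z =
          (if β y + γ z = α x ∧ (β y, γ z) ∈ P then (1 : ℂ) else 0)) ∧
      ∃ S : (Fin N → G) → (Fin N → G) → (Fin N → G) → ℂ,
        (∀ a b c : Fin N → G,
          kroneckerPow (fun a b c : G => if b + c = a ∧ (b, c) ∈ P then (1 : ℂ) else 0) N a b c =
            kroneckerPow (fun a b c : G => if b + c = a then (1 : ℂ) else 0) N a b c * S a b c) ∧
        (Fintype.card G : ℝ) ^ N * (tensorRank S : ℝ) ≤ ((p : ℝ) * (m : ℝ) ^ (2 + η)) ^ N := by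
  intro η _
  refine ⟨ZMod 1, inferInstance, inferInstance, inferInstance, Finset.univ, 1, 1, 1, le_rfl,
    le_rfl, ⟨fun _ => 0, fun _ => 0, fun _ => 0, ?_⟩, fun _ _ _ => 1, ?_, ?_⟩
  · rintro ⟨i, a₁, a₂⟩ ⟨j, b₁, b₂⟩ ⟨k, c₁, c₂⟩
    obtain rfl : i = j := Subsingleton.elim _ _
    obtain rfl : i = k := Subsingleton.elim _ _
    obtain rfl : a₁ = b₁ := Subsingleton.elim _ _
    obtain rfl : b₂ = c₁ := Subsingleton.elim _ _
    obtain rfl : a₂ = c₂ := Subsingleton.elim _ _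
    simp [matMulDirectSum]
  · intro a b c
    have hab : ∀ i, b i + c i = a i := fun i => Subsingleton.elim _ _
    simp [kroneckerPow, hab]
  · have h := (tensorRank_const_one_le (ι := Fin 1 → ZMod 1)
      (κ := Fin 1 → ZMod 1) (μ := Fin 1 → ZMod 1))
    have h' : (tensorRank (fun (_ : Fin 1 → ZMod 1) (_ : Fin 1 → ZMod 1)
        (_ : Fin 1 → ZMod 1) => (1 : ℂ)) : ℝ) ≤ 1 := by exact_mod_cast h
    simpa using h'

end Summit.MatrixMultiplication.MatrixMultiplication.Theorems.GrowingHostDesigns.Negative
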